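import Summits.QuantumFields.BalabanUV.Beta.GAN24.CurrentSymTower

/-!
# GAN24 ∕ PART VI ∕ T6-STEP SUPPLIER — Part 51: the two F5 antisymmetries of `unitS s_f s_m (SpureRecAt j)` at every DEEP period `N`, `Lc ∣ N`

[folklore] bookkeeping of the crux team's leaf 02: hypotheses `hL` ∕ `hR` of Part 50c `ForcingFacePairFormAssembly.forcingPairForm_dressedStep`
(Part 44's literal) for road-P2's first field table, from leaf-04 F5 (`CurrentSymTower.sym_SpureRecAt`, the (A)-tower for class data
`c + (Ψ(n+1) − Ψ(n))` face-supported at `Lc`; `parityOdd_SpureRecAt`).  The deep face indicator `𝟙[n ≡ −1 (mod N)]` IS such a class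
datum whenever `Lc ∣ N`: `𝟙[n ≡ −1 (N)] = N⁻¹ + (Φ_N(n+1) − Φ_N(n))`, `Φ_N(n) = −N⁻¹·(n mod N)` (`FaceDatumMultiplierResponse.sawtooth_step`
at modulus `N`), supported on `n ≡ −1 (mod Lc)`.  Hence (§2) the weighted-leg-first antisymmetry `hL` (units pull out a common factor) and
(§3) the free-leg-first antisymmetry `hR` (F5's parity transposition, verbatim at modulus `N`).

HONEST: NOT IN PRINT; nothing of `(C)_{≥1}` ∕ `hBF` is discharged here; NOT D1, NOT `BetaPertH`, NOT continuum, NOT Clay.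
-/

noncomputable section

open Finset
open scoped BigOperators
open Literature.MathematicalPhysics.QuantumFieldTheory
open Literature.MathematicalPhysics.QuantumFieldTheory.Balaban1983to89
open Literature.MathematicalPhysics.QuantumFieldTheory.Balaban1983to89.Beta
open ExpKernelCalculus (Site MKer)
open AffineAveraging (box toSite)
open OneStepResolventKernel (Fib)
open Summit.QuantumFields.BalabanUV.Beta.TameKernelCalculus (trK trK_apply)
open Summit.QuantumFields.BalabanUV.Beta.BorderedHessian (sgnK sgnK_apply sgnF sgnF_inl)
open Summit.QuantumFields.BalabanUV.Beta.HessKerDressedUnits (unitS unitS_apply legScale legScale_inl)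
open Summit.QuantumFields.BalabanUV.Beta.SpineRooted (SpureRecAt)
open Summit.QuantumFields.BalabanUV.Beta.GAN24.CurrentSymTower (sym_SpureRecAt parityOdd_SpureRecAt)

namespace Summit.QuantumFields.BalabanUV.Beta.GAN24.DeepFaceAntisymSpure

variable {d : ℕ} {Lc : ℕ} [NeZero Lc] {r : Fin (d + 1) → ℕ}

/-! ## §1 The deep face indicator is a class datum supported on the `Lc`-faces -/

/-- [folklore] `𝟙[n ≡ −1 (mod N)] = N⁻¹ + (Φ_N(n+1) − Φ_N(n))` with the sawtooth `Φ_N(n) = −N⁻¹·(n mod N)`. -/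
theorem deepFace_eq_classDatum {N : ℕ} (hN : 1 ≤ N) (n : ℤ) :
    (if n % (N : ℤ) = (N : ℤ) - 1 then (1 : ℝ) else 0)
      = (N : ℝ)⁻¹ + ((fun n : ℤ => -((N : ℝ)⁻¹) * (((n % (N : ℤ) : ℤ) : ℝ))) (n + 1) - (fun n : ℤ => -((N : ℝ)⁻¹) * (((n % (N : ℤ) : ℤ) : ℝ))) n) := by
  have hN0 : (N : ℝ) ≠ 0 := by exact_mod_cast (Nat.one_le_iff_ne_zero.mp hN)
  have hs := FaceDatumMultiplierResponse.sawtooth_step (Lc := N) hN n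
  have e : (N : ℝ)⁻¹ + ((fun n : ℤ => -((N : ℝ)⁻¹) * (((n % (N : ℤ) : ℤ) : ℝ))) (n + 1) - (fun n : ℤ => -((N : ℝ)⁻¹) * (((n % (N : ℤ) : ℤ) : ℝ))) n)
      = (N : ℝ)⁻¹ * (1 - (((((n + 1) % (N : ℤ) : ℤ) : ℝ)) - (((n % (N : ℤ) : ℤ) : ℝ)))) := by simp only; ring
  rw [e, hs]
  field_simp
  ring

/-- [folklore] The sawtooth is bounded by `1`. -/
theorem abs_sawtooth_le {N : ℕ} (hN : 1 ≤ N) (n : ℤ) :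
    |(fun n : ℤ => -((N : ℝ)⁻¹) * (((n % (N : ℤ) : ℤ) : ℝ))) n| ≤ 1 := by
  have hL : (0 : ℤ) < N := by exact_mod_cast hN
  have hLr : (0 : ℝ) < N := by exact_mod_cast hL
  have hm0 : (0 : ℝ) ≤ (((n % (N : ℤ) : ℤ) : ℝ)) := by exact_mod_cast Int.emod_nonneg _ hL.ne'
  have hm1 : (((n % (N : ℤ) : ℤ) : ℝ)) ≤ (N : ℝ) := by exact_mod_cast (Int.emod_lt_of_pos n hL).le
  simp only
  rw [abs_mul, abs_neg, abs_inv, abs_of_pos hLr, abs_of_nonneg hm0]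
  calc (N : ℝ)⁻¹ * (((n % (N : ℤ) : ℤ) : ℝ)) ≤ (N : ℝ)⁻¹ * (N : ℝ) := mul_le_mul_of_nonneg_left hm1 (by positivity)
    _ = 1 := by field_simp

omit [NeZero Lc] in
/-- [folklore] A deep face `n ≡ −1 (mod N)` is an `Lc`-face when `Lc ∣ N`; so the deep face datum is supported on the `Lc`-faces. -/
theorem deepFace_supported {N : ℕ} (hN : 1 ≤ N) (hLN : Lc ∣ N) (n : ℤ) (hn : n % (Lc : ℤ) ≠ (Lc : ℤ) - 1) :
    (N : ℝ)⁻¹ + ((fun n : ℤ => -((N : ℝ)⁻¹) * (((n % (N : ℤ) : ℤ) : ℝ))) (n + 1) - (fun n : ℤ => -((N : ℝ)⁻¹) * (((n % (N : ℤ) : ℤ) : ℝ))) n) = 0 := by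
  rw [← deepFace_eq_classDatum hN n, if_neg]
  intro hc
  apply hn
  have hLc : 1 ≤ Lc := Nat.pos_of_dvd_of_pos hLN hN
  obtain ⟨q, hq⟩ := hLN
  have hdvd : (Lc : ℤ) ∣ (N : ℤ) := ⟨q, by exact_mod_cast hq⟩
  -- `n + 1 ≡ 0 (mod N)` hence `(mod Lc)`
  have hN0 : ((N : ℤ)) ∣ n + 1 := by
    refine ⟨n / (N : ℤ) + 1, ?_⟩
    have h := Int.emod_def n (N : ℤ)
    rw [hc] at h
    linear_combination -h
  obtain ⟨k, hk⟩ := hdvd.trans hN0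
  have hLpos : (0 : ℤ) < Lc := by exact_mod_cast hLc
  have e : n = ((Lc : ℤ) - 1) + (Lc : ℤ) * (k - 1) := by linear_combination hk
  rw [e, Int.add_mul_emod_self_left]
  exact Int.emod_eq_of_lt (by omega) (by omega)

/-! ## §2 Weighted leg first (`hL` of Part 50c) -/

/-- [folklore] **DEEP-FACE ANTISYMMETRY OF THE FIRST FIELD TABLE, WEIGHTED LEG FIRST** (`hL` of Part 44 ∕ 50c at any period `N`, `Lc ∣ N`):
`Σ'_q [q_β]_N Σ'_u [u_ν]_N (unitS s_f s_m (SpureRecAt j)) ν u q p (inl β) a + Σ'_q [q_ν]_N Σ'_u [u_β]_N (unitS …) β u q p (inl ν) a = 0`. -/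
theorem deepFace_unitS_SpureRecAt_weightedFirst (hr : r ∈ box (d + 1) Lc) (sf sm cE cVH cΛ : ℝ) (j : ℕ) {N : ℕ} (hN : 1 ≤ N) (hLN : Lc ∣ N)
    (ν β : Fin (d + 1)) (p : Site (d + 1)) (a : Fib d) :
    (∑' q : Site (d + 1), (if q β % (N : ℤ) = (N : ℤ) - 1 then (1 : ℝ) else 0) *
        ∑' u : Site (d + 1), (if u ν % (N : ℤ) = (N : ℤ) - 1 then (1 : ℝ) else 0) * unitS sf sm (SpureRecAt d Lc (toSite r) cE cVH cΛ j) ν u q p (Sum.inl β) a) +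
      (∑' q : Site (d + 1), (if q ν % (N : ℤ) = (N : ℤ) - 1 then (1 : ℝ) else 0) *
        ∑' u : Site (d + 1), (if u β % (N : ℤ) = (N : ℤ) - 1 then (1 : ℝ) else 0) * unitS sf sm (SpureRecAt d Lc (toSite r) cE cVH cΛ j) β u q p (Sum.inl ν) a) = 0 := by
  set Φ : ℤ → ℝ := fun n : ℤ => -((N : ℝ)⁻¹) * (((n % (N : ℤ) : ℤ) : ℝ)) with hΦ
  have hface : ∀ n : ℤ, (if n % (N : ℤ) = (N : ℤ) - 1 then (1 : ℝ) else 0) = (N : ℝ)⁻¹ + (Φ (n + 1) - Φ n) := fun n => deepFace_eq_classDatum hN n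
  have hΦb : ∀ n, |Φ n| ≤ 1 := fun n => abs_sawtooth_le hN n
  have hff : ∀ n : ℤ, n % (Lc : ℤ) ≠ (Lc : ℤ) - 1 → (N : ℝ)⁻¹ + (Φ (n + 1) - Φ n) = 0 := fun n hn => deepFace_supported (Lc := Lc) hN hLN n hn
  have hT := sym_SpureRecAt hr cE cVH cΛ j ν β ((N : ℝ)⁻¹) Φ hΦb hff ((N : ℝ)⁻¹) Φ hΦb hff p a
  -- units: every entry picks up the common factor `(sf·sm)⁻¹·sf⁻¹·ℓ(a)`
  have eentry : ∀ (κ τ : Fin (d + 1)) (u q : Site (d + 1)), unitS sf sm (SpureRecAt d Lc (toSite r) cE cVH cΛ j) κ u q p (Sum.inl τ) a =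
      ((sf * sm)⁻¹ * sf⁻¹ * legScale sf⁻¹ sm⁻¹ a) * SpureRecAt d Lc (toSite r) cE cVH cΛ j κ u q p (Sum.inl τ) a := by
    intro κ τ u q
    rw [unitS_apply, legScale_inl]
    ring
  have eterm : ∀ (κ τ : Fin (d + 1)), (∑' q : Site (d + 1), (if q τ % (N : ℤ) = (N : ℤ) - 1 then (1 : ℝ) else 0) *
        ∑' u : Site (d + 1), (if u κ % (N : ℤ) = (N : ℤ) - 1 then (1 : ℝ) else 0) * unitS sf sm (SpureRecAt d Lc (toSite r) cE cVH cΛ j) κ u q p (Sum.inl τ) a) =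
      ((sf * sm)⁻¹ * sf⁻¹ * legScale sf⁻¹ sm⁻¹ a) *
        ∑' q : Site (d + 1), ((N : ℝ)⁻¹ + (Φ (q τ + 1) - Φ (q τ))) * ∑' u : Site (d + 1), ((N : ℝ)⁻¹ + (Φ (u κ + 1) - Φ (u κ))) *
          SpureRecAt d Lc (toSite r) cE cVH cΛ j κ u q p (Sum.inl τ) a := by
    intro κ τ
    rw [← tsum_mul_left]
    refine tsum_congr fun q => ?_
    rw [← hface (q τ)]
    have ein : ∑' u : Site (d + 1), (if u κ % (N : ℤ) = (N : ℤ) - 1 then (1 : ℝ) else 0) * unitS sf sm (SpureRecAt d Lc (toSite r) cE cVH cΛ j) κ u q p (Sum.inl τ) a =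
        ((sf * sm)⁻¹ * sf⁻¹ * legScale sf⁻¹ sm⁻¹ a) * ∑' u : Site (d + 1), ((N : ℝ)⁻¹ + (Φ (u κ + 1) - Φ (u κ))) * SpureRecAt d Lc (toSite r) cE cVH cΛ j κ u q p (Sum.inl τ) a := by
      rw [← tsum_mul_left]
      refine tsum_congr fun u => ?_
      rw [← hface (u κ), eentry]
      ring
    rw [ein]
    ring
  rw [eterm ν β, eterm β ν, ← mul_add, hT, mul_zero]

/-! ## §3 Free leg first (`hR` of Part 50c) -/

/-- [folklore] **DEEP-FACE ANTISYMMETRY OF THE FIRST FIELD TABLE, FREE LEG FIRST** (`hR` of Part 44 ∕ 50c at any period `N`, `Lc ∣ N`; F5's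
parity transposition `parityOdd_SpureRecAt` at modulus `N`):
`Σ'_{s′} [s′_ν]_N Σ'_{t′} [t′_μ]_N (unitS s_f s_m (SpureRecAt j)) μ t′ s s′ f (inl ν) + Σ'_{s′} [s′_μ]_N Σ'_{t′} [t′_ν]_N (unitS …) ν t′ s s′ f (inl μ) = 0`. -/
theorem deepFace_unitS_SpureRecAt_freeFirst (hr : r ∈ box (d + 1) Lc) (sf sm cE cVH cΛ : ℝ) (j : ℕ) {N : ℕ} (hN : 1 ≤ N) (hLN : Lc ∣ N)
    (μ ν : Fin (d + 1)) (s : Site (d + 1)) (f : Fib d) :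
    (∑' s' : Site (d + 1), (if s' ν % (N : ℤ) = (N : ℤ) - 1 then (1 : ℝ) else 0) *
        ∑' t' : Site (d + 1), (if t' μ % (N : ℤ) = (N : ℤ) - 1 then (1 : ℝ) else 0) * unitS sf sm (SpureRecAt d Lc (toSite r) cE cVH cΛ j) μ t' s s' f (Sum.inl ν)) +
      (∑' s' : Site (d + 1), (if s' μ % (N : ℤ) = (N : ℤ) - 1 then (1 : ℝ) else 0) *
        ∑' t' : Site (d + 1), (if t' ν % (N : ℤ) = (N : ℤ) - 1 then (1 : ℝ) else 0) * unitS sf sm (SpureRecAt d Lc (toSite r) cE cVH cΛ j) ν t' s s' f (Sum.inl μ)) = 0 := by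
  set Φ : ℤ → ℝ := fun n : ℤ => -((N : ℝ)⁻¹) * (((n % (N : ℤ) : ℤ) : ℝ)) with hΦ
  have hface : ∀ n : ℤ, (if n % (N : ℤ) = (N : ℤ) - 1 then (1 : ℝ) else 0) = (N : ℝ)⁻¹ + (Φ (n + 1) - Φ n) := fun n => deepFace_eq_classDatum hN n
  have hΦb : ∀ n, |Φ n| ≤ 1 := fun n => abs_sawtooth_le hN n
  have hff : ∀ n : ℤ, n % (Lc : ℤ) ≠ (Lc : ℤ) - 1 → (N : ℝ)⁻¹ + (Φ (n + 1) - Φ n) = 0 := fun n hn => deepFace_supported (Lc := Lc) hN hLN n hn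
  -- the tower for the pure table, weighted leg first, free leg `(s, f)` second
  have hT := sym_SpureRecAt hr cE cVH cΛ j μ ν ((N : ℝ)⁻¹) Φ hΦb hff ((N : ℝ)⁻¹) Φ hΦb hff s f
  -- parity transposition with units: every entry picks up the same factor
  have hpar := parityOdd_SpureRecAt hr cE cVH cΛ j
  have eentry : ∀ (κ τ : Fin (d + 1)) (t' s' : Site (d + 1)), unitS sf sm (SpureRecAt d Lc (toSite r) cE cVH cΛ j) κ t' s s' f (Sum.inl τ) =
      (-((sf * sm)⁻¹ * legScale sf⁻¹ sm⁻¹ f * sf⁻¹ * sgnF f)) * SpureRecAt d Lc (toSite r) cE cVH cΛ j κ t' s' s (Sum.inl τ) f := by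
    intro κ τ t' s'
    rw [unitS_apply, legScale_inl]
    have h := congrFun (congrFun (congrFun (congrFun (hpar κ t') s') s) (Sum.inl τ)) f
    rw [trK_apply] at h
    rw [h]
    simp only [Pi.neg_apply, sgnK_apply, sgnF_inl, one_mul]
    ring
  have eterm : ∀ (κ τ : Fin (d + 1)), (∑' s' : Site (d + 1), (if s' τ % (N : ℤ) = (N : ℤ) - 1 then (1 : ℝ) else 0) *
        ∑' t' : Site (d + 1), (if t' κ % (N : ℤ) = (N : ℤ) - 1 then (1 : ℝ) else 0) * unitS sf sm (SpureRecAt d Lc (toSite r) cE cVH cΛ j) κ t' s s' f (Sum.inl τ)) =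
      (-((sf * sm)⁻¹ * legScale sf⁻¹ sm⁻¹ f * sf⁻¹ * sgnF f)) *
        ∑' s' : Site (d + 1), ((N : ℝ)⁻¹ + (Φ (s' τ + 1) - Φ (s' τ))) * ∑' t' : Site (d + 1), ((N : ℝ)⁻¹ + (Φ (t' κ + 1) - Φ (t' κ))) *
          SpureRecAt d Lc (toSite r) cE cVH cΛ j κ t' s' s (Sum.inl τ) f := by
    intro κ τ
    rw [← tsum_mul_left]
    refine tsum_congr fun s' => ?_
    rw [← hface (s' τ)]
    have ein : ∑' t' : Site (d + 1), (if t' κ % (N : ℤ) = (N : ℤ) - 1 then (1 : ℝ) else 0) * unitS sf sm (SpureRecAt d Lc (toSite r) cE cVH cΛ j) κ t' s s' f (Sum.inl τ) =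
        (-((sf * sm)⁻¹ * legScale sf⁻¹ sm⁻¹ f * sf⁻¹ * sgnF f)) * ∑' t' : Site (d + 1), ((N : ℝ)⁻¹ + (Φ (t' κ + 1) - Φ (t' κ))) * SpureRecAt d Lc (toSite r) cE cVH cΛ j κ t' s' s (Sum.inl τ) f := by
      rw [← tsum_mul_left]
      refine tsum_congr fun t' => ?_
      rw [← hface (t' κ), eentry]
      ring
    rw [ein]
    ring
  rw [eterm μ ν, eterm ν μ, ← mul_add, hT, mul_zero]

end Summit.QuantumFields.BalabanUV.Beta.GAN24.DeepFaceAntisymSpure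

end
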